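import Literature.AlgebraicGeometry.Resolution.LogRegularChartNonzero
import HarnessLib

/-!
# The structure monoid of a log regular chart is sharp modulo units (Nizioł 2006, Lemma 2.4 (1))

`Literature/AlgebraicGeometry/Resolution/LogRegularSharpening.lean`. For a logarithmically
regular `(X, M)`, W. Nizioł, *Toric singularities: log-blow-ups and global resolutions*,
J. Algebraic Geom. 15 (2006), Lemma 2.4 (1) (after K. Kato, *Toric singularities*,
Amer. J. Math. 116 (1994), (3.2), (4.1), (6.2)): the structure map `M_x → 𝒪_{X,x}` is injective
and `M_x^{gp}/𝒪^*_{X,x} ≅ P^{gp}/F^{gp}` for a chart `P → 𝒪_{X,x}` with `F` the face of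
elements mapping to units. Concretely, for a chart `φ : P → A` log regular at a prime `𝔭`
(Kato Def. (2.1)): **if `φ(p)` and `φ(p')` differ by a unit of `A_𝔭` then `p − p'` lies in the
group generated by the face `F_𝔭 = φ⁻¹(A ∖ 𝔭)`** — the converse being trivial. In the completed
picture `𝒪̂ ≅ R⟦P⟧/(θ)` ((3.2), `LogRegularCompleteStructure.ker_eq_span_theta`) this is the
remark that `x^w − ũ·x^{w'}` is never a multiple of `θ` when `ũ` is a unit and `w ≠ w'`
(`θ ≡ π mod (P ∖ 0)`, compare lowest coefficients), exactly as for the non-vanishing of chart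
elements (`LogRegularChartNonzero.lean`). This is the SHARPENING step of Kato's fan `F(X)` (the
stalk `M_x/𝒪^*_x` of a log regular log structure is the sharp quotient `P/F` of any of its
charts), used to compare the charts of a log regular atlas on overlaps ((10.4), atlas form).

* `monomial_sub_mul_monomial_ne_theta_mul` — `x^w − ũ x^{w'} ≠ θ g` in `Λ⟦X⟧`;
* `chart_eq_of_isUnit_mul_of_dform0`, `chart_eq_of_isUnit_mul_of_dform` — d-form chart data on
  a Noetherian local ring: `φ(w) = u φ(w')` with `u` a unit forces `w = w'`;
* `LogChart.sub_mem_span_faceMonoid_of_isLogRegularAt` — **log regular at `𝔭`, `φ(p) ∈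
  A_𝔭^* · φ(p')` ⇒ `p − p' ∈ ℤF_𝔭`**; `LogChart.exists_isUnit_mul_of_sub_mem_span_faceMonoid` —
  the converse; `LogChart.sub_mem_span_faceMonoid_iff` — the equivalence.

References: [Niziol2006] W. Nizioł, Toric singularities: log-blow-ups and global resolutions,
J. Algebraic Geom. 15 (2006), Lemma 2.4 (1); [Kato1994] K. Kato, Toric singularities,
Amer. J. Math. 116 (1994), (3.2), (4.1), (10.4).
-/

noncomputable section

open IsLocalRing MvPowerSeries Literature.RingTheory.MvPowerSeries
  Literature.RingTheory.MvPowerSeries.monoidPowerSeries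
  Literature.RingTheory.CompleteLocalRings

namespace Literature.AlgebraicGeometry.Resolution

namespace LogRegularCompleteStructure

universe u

/-! ### `x^w − ũ x^{w'}` is not a multiple of `θ` -/

/-- **`x^w − ũ·x^{w'} ∉ (θ)`**: in `Λ⟦Xᵢ⟧`, if the constant coefficient of `θ` is a
non-zero-divisor and not a unit, `ũ` has unit constant coefficient and `w ≠ w'`, then
`x^w − ũ x^{w'} ≠ θ · g` (compare the coefficient at `w'`, resp. at an exponent of least degree in
the support of `g`). [cite: Niziol2006, Lemma 2.4] -/
theorem monomial_sub_mul_monomial_ne_theta_mul {σ : Type*} {Λ : Type u} [CommRing Λ]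
    (θ g ũ : MvPowerSeries σ Λ) (hπ : MvPowerSeries.constantCoeff θ ∈ nonZeroDivisors Λ)
    (hπu : ¬IsUnit (MvPowerSeries.constantCoeff θ))
    (hũ : IsUnit (MvPowerSeries.constantCoeff ũ)) {w w' : σ →₀ ℕ} (hww' : w ≠ w') :
    MvPowerSeries.monomial w (1 : Λ) - ũ * MvPowerSeries.monomial w' 1 ≠ θ * g := by
  classical
  intro heq
  have hnt : Nontrivial Λ := by
    by_contra h
    haveI := not_nontrivial_iff_subsingleton.1 h
    exact hπu (isUnit_of_subsingleton _)
  -- the coefficient of the left-hand side at `w'` is the unit `-ũ(0)`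
  have hLw' : MvPowerSeries.coeff w' (MvPowerSeries.monomial w (1 : Λ) - ũ * MvPowerSeries.monomial w' 1)
      = -MvPowerSeries.constantCoeff ũ := by
    rw [map_sub, MvPowerSeries.coeff_monomial, if_neg (Ne.symm hww'), MvPowerSeries.coeff_mul_monomial,
      if_pos le_rfl, tsub_self, mul_one, MvPowerSeries.coeff_zero_eq_constantCoeff, zero_sub]
  -- `g ≠ 0`
  have hg0 : g ≠ 0 := by
    intro h0
    rw [h0, mul_zero] at heq
    have h10 := congrArg (MvPowerSeries.coeff w') heq
    rw [hLw', map_zero, neg_eq_zero] at h10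
    exact not_isUnit_zero (h10 ▸ hũ)
  -- an exponent of minimal degree in the support of `g`
  obtain ⟨v₁, hv₁⟩ : ∃ v, MvPowerSeries.coeff v g ≠ 0 := by
    by_contra h
    push Not at h
    exact hg0 (MvPowerSeries.ext fun v => by rw [h v, map_zero])
  have hex : ∃ m : ℕ, ∃ v, v.degree = m ∧ MvPowerSeries.coeff v g ≠ 0 := ⟨_, v₁, rfl, hv₁⟩
  let m₀ := Nat.find hex
  obtain ⟨v₀, hv₀deg, hv₀⟩ : ∃ v, v.degree = m₀ ∧ MvPowerSeries.coeff v g ≠ 0 := Nat.find_spec hex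
  have hmin : ∀ v : σ →₀ ℕ, v.degree < m₀ → MvPowerSeries.coeff v g = 0 := by
    intro v hv
    by_contra hne
    exact Nat.find_min hex hv ⟨v, rfl, hne⟩
  -- the coefficient of `θ g` at an exponent `v` all of whose lower exponents are off the support
  have hcoeffθ : ∀ v : σ →₀ ℕ, (∀ b : σ →₀ ℕ, b ≤ v → b ≠ v → MvPowerSeries.coeff b g = 0) →
      MvPowerSeries.coeff v (θ * g) = MvPowerSeries.constantCoeff θ * MvPowerSeries.coeff v g := by
    intro v hv
    rw [MvPowerSeries.coeff_mul, Finset.sum_eq_single (0, v)]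
    · rw [MvPowerSeries.coeff_zero_eq_constantCoeff]
    · rintro ⟨a, b⟩ hab hne
      rw [Finset.HasAntidiagonal.mem_antidiagonal] at hab
      simp only at hab
      have ha0 : a ≠ 0 := by
        rintro rfl; rw [zero_add] at hab; exact hne (by rw [hab])
      have hble : b ≤ v := by rw [← hab]; exact le_add_self
      have hbne : b ≠ v := by
        intro hbv
        apply ha0
        have := congrArg (fun x => x - b) hab
        simp only [hbv, add_tsub_cancel_right, tsub_self] at this
        exact this
      simp only
      rw [hv b hble hbne, mul_zero]
    · intro h
      exact (h (Finset.HasAntidiagonal.mem_antidiagonal.2 (zero_add v))).elim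
  by_cases hdeg : w'.degree < m₀
  · -- compare at `w'`: all `g_b`, `b ≤ w'`, vanish
    have h1 := congrArg (MvPowerSeries.coeff w') heq
    rw [hLw', hcoeffθ w' (fun b hb _ => hmin b (lt_of_le_of_lt (by
        obtain ⟨c, rfl⟩ := exists_add_of_le hb
        rw [map_add]; exact Nat.le_add_right _ _) hdeg)),
      hmin w' hdeg, mul_zero, neg_eq_zero] at h1
    exact not_isUnit_zero (h1 ▸ hũ)
  · -- compare at `v₀`
    push Not at hdeg
    have hθv₀ : MvPowerSeries.coeff v₀ (θ * g) = MvPowerSeries.constantCoeff θ * MvPowerSeries.coeff v₀ g :=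
      hcoeffθ v₀ fun b hb hne => hmin b (by
        rw [← hv₀deg]
        obtain ⟨c, rfl⟩ := exists_add_of_le hb
        have hc0 : c ≠ 0 := by rintro rfl; exact hne (by rw [add_zero])
        rw [map_add]
        have : 0 < c.degree := by
          rw [pos_iff_ne_zero, Ne, Finsupp.degree_eq_zero_iff]; exact hc0
        omega)
    have h1 := congrArg (MvPowerSeries.coeff v₀) heq
    rw [hθv₀, map_sub, MvPowerSeries.coeff_monomial, MvPowerSeries.coeff_mul_monomial] at h1
    by_cases hle : w' ≤ v₀
    · -- then `w' = v₀` (otherwise `deg w' < deg v₀ = m₀`)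
      have hwv : w' = v₀ := by
        by_contra hne
        obtain ⟨c, hc⟩ := exists_add_of_le hle
        have hc0 : c ≠ 0 := by rintro rfl; exact hne (by rw [hc, add_zero])
        have : w'.degree < m₀ := by
          rw [← hv₀deg, hc, map_add]
          have : 0 < c.degree := by
            rw [pos_iff_ne_zero, Ne, Finsupp.degree_eq_zero_iff]; exact hc0
          omega
        exact absurd this (not_lt.2 hdeg)
      subst hwv
      rw [if_neg (Ne.symm hww'), if_pos le_rfl, tsub_self, MvPowerSeries.coeff_zero_eq_constantCoeff,
        mul_one, zero_sub] at h1
      -- `-ũ(0) = θ(0) g(w')`: `θ(0)` would be a unit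
      have hu' : IsUnit (MvPowerSeries.constantCoeff θ * MvPowerSeries.coeff w' g) := by
        rw [← h1]; exact hũ.neg
      exact hπu (isUnit_of_mul_isUnit_left hu')
    · rw [if_neg hle, sub_zero] at h1
      split_ifs at h1 with hwv
      · exact hπu (isUnit_iff_exists_inv.2 ⟨_, h1.symm⟩)
      · exact hv₀ ((mul_left_mem_nonZeroDivisors_eq_zero_iff hπ).1 h1.symm)

/-- In a local ring, `1 + m` is a unit for `m ∈ 𝔪`. [cite: Kato1994, (3.2)] -/
theorem isUnit_of_sub_one_mem_maximalIdeal {R : Type u} [CommRing R] [IsLocalRing R] {x : R}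
    (hx : x - 1 ∈ maximalIdeal R) : IsUnit x := by
  by_contra h
  have hx' : x ∈ maximalIdeal R := (mem_maximalIdeal _).2 (mem_nonunits_iff.2 h)
  have h1 : (1 : R) ∈ maximalIdeal R := by
    have := Ideal.sub_mem _ hx' hx
    rwa [sub_sub_cancel] at this
  exact (mem_maximalIdeal _).1 h1 isUnit_one

/-! ### Chart elements differing by a unit are equal (d-form chart data) -/

variable {A : Type u} [CommRing A] [IsLocalRing A] [IsNoetherianRing A] {M d : ℕ}
  {P : AddSubmonoid (Fin M →₀ ℕ)} {φ : (Fin M →₀ ℕ) → A}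

/-- **`φ(w) = u·φ(w')` with `u` a unit forces `w = w'`** for d = 0 chart data
(`𝔪_A = (φ(P ∖ 0))`, `dim A = rank P`): in `Â ≅ Λ⟦P⟧/(θ)` the element `x^w − ũ x^{w'}`
(`ũ` a lift of `u`, a unit) would lie in `(θ)`. [cite: Niziol2006, Lemma 2.4] [cite: Kato1994, (3.2)] -/
theorem chart_eq_of_isUnit_mul_of_dform0 (hP : P.FG) (hφ0 : φ 0 = 1)
    (hφadd : ∀ a ∈ P, ∀ b ∈ P, φ (a + b) = φ a * φ b)
    (hφm : ∀ p ∈ P, p ≠ 0 → φ p ∈ maximalIdeal A)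
    (hgen : maximalIdeal A ≤ Ideal.span (φ '' {p | p ∈ P ∧ p ≠ 0}))
    (hdim : ringKrullDim A = rank P) {w w' : Fin M →₀ ℕ} (hw : w ∈ P) (hw' : w' ∈ P)
    {u : A} (hu : IsUnit u) (h : φ w = u * φ w') : w = w' := by
  classical
  by_contra hww'
  haveI : IsNoetherianRing (AdicCompletion (maximalIdeal A) A) :=
    isNoetherianRing_adicCompletion_maximalIdeal A
  let φh : (Fin M →₀ ℕ) → AdicCompletion (maximalIdeal A) A := fun p => algebraMap A _ (φ p)
  have hφh0 : φh 0 = 1 := by simp only [φh, hφ0, map_one]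
  have hφhadd : ∀ a ∈ P, ∀ b ∈ P, φh (a + b) = φh a * φh b := by
    intro a ha b hb; simp only [φh, hφadd a ha b hb, map_mul]
  have hφhm : ∀ p ∈ P, p ≠ 0 → φh p ∈ maximalIdeal (AdicCompletion (maximalIdeal A) A) := by
    intro p hp hp0
    rw [AdicCompletion.maximalIdeal_eq_map]
    exact Ideal.mem_map_of_mem _ (hφm p hp hp0)
  have hgenh : maximalIdeal (AdicCompletion (maximalIdeal A) A) ≤
      Ideal.span (φh '' {p | p ∈ P ∧ p ≠ 0}) := by
    rw [AdicCompletion.maximalIdeal_eq_map]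
    refine (Ideal.map_mono hgen).trans ?_
    rw [Ideal.map_span, ← Set.image_comp]
    rfl
  have hdimh : ringKrullDim (AdicCompletion (maximalIdeal A) A) = rank P := by
    rw [ringKrullDim_adicCompletion A, hdim]
  -- the unit `û` and its inverse in `Â`
  obtain ⟨u', hu'⟩ := hu.exists_left_inv
  set uh : AdicCompletion (maximalIdeal A) A := algebraMap A _ u with huh
  set uh' : AdicCompletion (maximalIdeal A) A := algebraMap A _ u' with huh'
  have huu : uh' * uh = 1 := by rw [huh, huh', ← map_mul, hu', map_one]
  have hrel : φh w = uh * φh w' := by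
    show algebraMap A _ (φ w) = algebraMap A _ u * algebraMap A _ (φ w')
    rw [← map_mul, h]
  -- the key step, for a surjection `ψ : R⟦P⟧ → Â` with lifts `ũ, ũ'` of `û, û'`
  have key : ∀ {R : Type u} [CommRing R] (ψ : monoidPowerSeries R P →+* AdicCompletion (maximalIdeal A) A),
      (∀ (p : Fin M →₀ ℕ) (hp : p ∈ P),
        ψ ⟨MvPowerSeries.monomial p (1 : R), monomial_mem hp 1⟩ = φh p) →
      ∀ ũ ũ' : monoidPowerSeries R P, ψ ũ = uh → ψ ũ' = uh' →
        (⟨MvPowerSeries.monomial w (1 : R), monomial_mem hw 1⟩ - ũ *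
            ⟨MvPowerSeries.monomial w' (1 : R), monomial_mem hw' 1⟩ : monoidPowerSeries R P) ∈
          RingHom.ker ψ ∧ ũ' * ũ - 1 ∈ RingHom.ker ψ := by
    intro R _ ψ hψmon ũ ũ' hũ hũ'
    constructor
    · rw [RingHom.mem_ker, map_sub, map_mul, hψmon w hw, hψmon w' hw', hũ, hrel, sub_self]
    · rw [RingHom.mem_ker, map_sub, map_mul, hũ, hũ', map_one, huu, sub_self]
  obtain ⟨p, hp⟩ := CharP.exists (ResidueField (AdicCompletion (maximalIdeal A) A))
  rcases CharP.char_is_prime_or_zero (ResidueField (AdicCompletion (maximalIdeal A) A)) p with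
    hprime | rfl
  · haveI : Fact p.Prime := ⟨hprime⟩
    obtain ⟨R, _, _, _, hRN, hRc, hmax, hp0, j, hres⟩ :=
      exists_cohenDVR_ringHom (AdicCompletion (maximalIdeal A) A) p
    haveI := hRN
    haveI := hRc
    have hpA : (p : AdicCompletion (maximalIdeal A) A) ∈
        maximalIdeal (AdicCompletion (maximalIdeal A) A) := by
      rw [← residue_eq_zero_iff, map_natCast]; exact CharP.cast_eq_zero _ p
    haveI : IsLocalHom j := by
      refine ⟨fun r hr => ?_⟩
      by_contra hrn
      have hrm : r ∈ maximalIdeal R := (mem_maximalIdeal _).2 (mem_nonunits_iff.2 hrn)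
      rw [hmax, Ideal.mem_span_singleton] at hrm
      obtain ⟨s, rfl⟩ := hrm
      rw [map_mul, map_natCast] at hr
      exact ((mem_maximalIdeal _).1 (Ideal.mul_mem_right _ _ hpA)) hr
    obtain ⟨ψ, hψsurj, hψmon, hψC⟩ := exists_lift_surjective j hres hP φh hφh0 hφhadd hφhm hgenh
    have hjp : j (p : R) ∈ maximalIdeal _ := by rw [map_natCast]; exact hpA
    obtain ⟨θ, hθ, hθπ⟩ := exists_theta ψ hψsurj j hψC φh hψmon hgenh (p : R) hjp
    have hker := ker_eq_span_theta hp0 hmax hP ψ hψsurj hdimh θ hθ hθπ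
    obtain ⟨ũ, hũ⟩ := hψsurj uh
    obtain ⟨ũ', hũ'⟩ := hψsurj uh'
    obtain ⟨hX, hU⟩ := key ψ hψmon ũ ũ' hũ hũ'
    rw [hker, Ideal.mem_span_singleton'] at hX hU
    obtain ⟨g, hg⟩ := hX
    obtain ⟨g', hg'⟩ := hU
    have hπm : (p : R) ∈ maximalIdeal R := hmax ▸ Ideal.subset_span rfl
    -- `ũ(0)` is a unit: `ũ' ũ - 1 = g' θ` has constant coefficient in `(p) = 𝔪_R`
    have hũ0 : IsUnit (MvPowerSeries.constantCoeff (ũ : MvPowerSeries (Fin M) R)) := by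
      have hval := congrArg (fun x : monoidPowerSeries R P => MvPowerSeries.constantCoeff
        (x : MvPowerSeries (Fin M) R)) hg'
      simp only [Subalgebra.coe_mul, Subalgebra.coe_sub, Subalgebra.coe_one, map_mul, map_sub,
        map_one, hθπ] at hval
      have hunit : IsUnit (MvPowerSeries.constantCoeff (ũ' : MvPowerSeries (Fin M) R) *
          MvPowerSeries.constantCoeff (ũ : MvPowerSeries (Fin M) R)) :=
        isUnit_of_sub_one_mem_maximalIdeal (by rw [← hval]; exact Ideal.mul_mem_left _ _ hπm)
      exact isUnit_of_mul_isUnit_right hunit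
    have hval := congrArg Subtype.val hg
    rw [Subalgebra.coe_mul] at hval
    refine monomial_sub_mul_monomial_ne_theta_mul (θ : MvPowerSeries (Fin M) R)
      (g : MvPowerSeries (Fin M) R) (ũ : MvPowerSeries (Fin M) R) ?_ ?_ hũ0 hww' ?_
    · rw [hθπ]; exact mem_nonZeroDivisors_of_ne_zero hp0
    · rw [hθπ]; exact (mem_maximalIdeal _).1 hπm
    · simp only [Subalgebra.coe_sub, Subalgebra.coe_mul] at hval
      rw [mul_comm (θ : MvPowerSeries (Fin M) R)]
      exact hval.symm
  · haveI : CharZero (ResidueField (AdicCompletion (maximalIdeal A) A)) := CharP.charP_to_charZero _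
    obtain ⟨σ, hσ⟩ := exists_coefficientField_of_charZero (AdicCompletion (maximalIdeal A) A)
    have hbot : maximalIdeal (ResidueField (AdicCompletion (maximalIdeal A) A)) = ⊥ :=
      (IsLocalRing.isField_iff_maximalIdeal_eq).1 (Field.toIsField _)
    haveI : IsAdicComplete (maximalIdeal (ResidueField (AdicCompletion (maximalIdeal A) A)))
        (ResidueField (AdicCompletion (maximalIdeal A) A)) := by rw [hbot]; infer_instance
    haveI : IsLocalHom σ := by
      refine ⟨fun x hx => ?_⟩
      by_contra hxn
      have hx0 : x = 0 := by by_contra h; exact hxn (Ne.isUnit h)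
      rw [hx0, map_zero] at hx
      exact not_isUnit_zero hx
    have hres : ∀ a : AdicCompletion (maximalIdeal A) A, ∃ l, a - σ l ∈ maximalIdeal _ :=
      fun a => ⟨residue _ a, by rw [← residue_eq_zero_iff, map_sub, hσ, sub_self]⟩
    obtain ⟨ψ, hψsurj, hψmon, -⟩ := exists_lift_surjective σ hres hP φh hφh0 hφhadd hφhm hgenh
    have hker := ker_eq_bot_of_field hP ψ hψsurj hdimh
    obtain ⟨ũ, hũ⟩ := hψsurj uh
    obtain ⟨ũ', hũ'⟩ := hψsurj uh'
    obtain ⟨hX, hU⟩ := key ψ hψmon ũ ũ' hũ hũ'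
    rw [hker, Ideal.mem_bot] at hX hU
    have hU' := congrArg (fun x : monoidPowerSeries _ P => MvPowerSeries.constantCoeff
      (x : MvPowerSeries (Fin M) (ResidueField (AdicCompletion (maximalIdeal A) A)))) hU
    simp only [Subalgebra.coe_mul, Subalgebra.coe_sub, Subalgebra.coe_one, Subalgebra.coe_zero,
      map_mul, map_sub, map_one, map_zero, sub_eq_zero] at hU'
    have hũ0 : MvPowerSeries.constantCoeff (ũ : MvPowerSeries (Fin M)
        (ResidueField (AdicCompletion (maximalIdeal A) A))) ≠ 0 := by
      intro h0; rw [h0, mul_zero] at hU'; exact zero_ne_one hU'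
    have hX' := congrArg (fun x : monoidPowerSeries _ P => MvPowerSeries.coeff w'
      (x : MvPowerSeries (Fin M) (ResidueField (AdicCompletion (maximalIdeal A) A)))) hX
    simp only [Subalgebra.coe_sub, Subalgebra.coe_mul, Subalgebra.coe_zero, map_sub, map_zero] at hX'
    rw [MvPowerSeries.coeff_monomial, if_neg (Ne.symm hww'), MvPowerSeries.coeff_mul_monomial,
      if_pos le_rfl, tsub_self, mul_one, MvPowerSeries.coeff_zero_eq_constantCoeff, zero_sub,
      neg_eq_zero] at hX'
    exact hũ0 hX'

/-- **`φ(w) = u·φ(w')` with `u` a unit forces `w = w'`, d-form**: with parameters `t₁..t_d`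
(`𝔪 = (φ(P ∖ 0)) + (t)`, `rank P + d ≤ dim A`). [cite: Niziol2006, Lemma 2.4] -/
theorem chart_eq_of_isUnit_mul_of_dform {t : Fin d → A} (hP : P.FG) (hφ0 : φ 0 = 1)
    (hφadd : ∀ a ∈ P, ∀ b ∈ P, φ (a + b) = φ a * φ b)
    (hφm : ∀ p ∈ P, p ≠ 0 → φ p ∈ maximalIdeal A) (ht : ∀ k, t k ∈ maximalIdeal A)
    (hgen : maximalIdeal A ≤ Ideal.span (φ '' {p | p ∈ P ∧ p ≠ 0}) ⊔ Ideal.span (Set.range t))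
    (hdim : ((rank P + d : ℕ) : WithBot ℕ∞) ≤ ringKrullDim A) {w w' : Fin M →₀ ℕ} (hw : w ∈ P)
    (hw' : w' ∈ P) {u : A} (hu : IsUnit u) (h : φ w = u * φ w') : w = w' := by
  have hdim' : ringKrullDim A = rank (absorbMonoid P d) := by
    rw [rank_absorbMonoid]
    exact le_antisymm (ringKrullDim_le_rank_add hP hφ0 hφadd hφm ht hgen) hdim
  have h1 := chart_eq_of_isUnit_mul_of_dform0 (absorbMonoid_fg hP) (absorbChart_zero hφ0 t)
    (absorbChart_add hφadd t) (absorbChart_mem_maximalIdeal hφm ht)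
    (maximalIdeal_le_span_absorbChart hφ0 hgen) hdim' (absorbGlue_mem hw 0) (absorbGlue_mem hw' 0)
    hu (by rw [absorbChart_absorbGlue_zero, absorbChart_absorbGlue_zero]; exact h)
  have h2 := congrArg (absorbProj₁ M d) h1
  rwa [absorbProj₁_absorbGlue, absorbProj₁_absorbGlue] at h2

end LogRegularCompleteStructure

namespace LogChart

universe v

variable {A : Type v} [CommRing A] {n : ℕ} {P : AddSubmonoid (Fin n → ℤ)}
  {φ : Multiplicative P →* A} {𝔭 : Ideal A} [𝔭.IsPrime]

/-- The trivial direction: if `p − p' ∈ ℤ F_𝔭` then `φ(p)` and `φ(p')` differ by a unit of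
`A_𝔭` (write `p − p' = f − f'` with `f, f' ∈ F_𝔭`, whose images are units).
[cite: Niziol2006, Lemma 2.4] -/
theorem exists_isUnit_mul_of_sub_mem_span_faceMonoid (p p' : P)
    (h : (p : Fin n → ℤ) - p' ∈ Submodule.span ℤ (faceMonoid P φ 𝔭 : Set (Fin n → ℤ))) :
    ∃ u : Localization.AtPrime 𝔭, IsUnit u ∧
      algebraMap A (Localization.AtPrime 𝔭) (φ (Multiplicative.ofAdd p)) =
        u * algebraMap A (Localization.AtPrime 𝔭) (φ (Multiplicative.ofAdd p')) := by
  -- `ℤF = F − F`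
  have hFF : ∀ x ∈ Submodule.span ℤ (faceMonoid P φ 𝔭 : Set (Fin n → ℤ)),
      ∃ f ∈ faceMonoid P φ 𝔭, ∃ f' ∈ faceMonoid P φ 𝔭, x = f - f' := by
    intro x hx
    induction hx using Submodule.span_induction with
    | mem x hx => exact ⟨x, hx, 0, (faceMonoid P φ 𝔭).zero_mem, (sub_zero x).symm⟩
    | zero => exact ⟨0, (faceMonoid P φ 𝔭).zero_mem, 0, (faceMonoid P φ 𝔭).zero_mem, (sub_zero 0).symm⟩
    | add x y _ _ hx hy =>
      obtain ⟨f, hf, f', hf', rfl⟩ := hx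
      obtain ⟨g, hg, g', hg', rfl⟩ := hy
      exact ⟨f + g, (faceMonoid P φ 𝔭).add_mem hf hg, f' + g', (faceMonoid P φ 𝔭).add_mem hf' hg',
        by abel⟩
    | smul a x _ hx =>
      obtain ⟨f, hf, f', hf', rfl⟩ := hx
      rcases Int.eq_nat_or_neg a with ⟨k, rfl | rfl⟩
      · exact ⟨k • f, (faceMonoid P φ 𝔭).nsmul_mem hf k, k • f', (faceMonoid P φ 𝔭).nsmul_mem hf' k,
          by rw [smul_sub, ← natCast_zsmul, ← natCast_zsmul]⟩
      · exact ⟨k • f', (faceMonoid P φ 𝔭).nsmul_mem hf' k, k • f, (faceMonoid P φ 𝔭).nsmul_mem hf k,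
          by rw [smul_sub, neg_smul, neg_smul, ← natCast_zsmul, ← natCast_zsmul]; abel⟩
  obtain ⟨f, hf, f', hf', hff⟩ := hFF _ h
  -- `p + f' = p' + f`
  have hpf : (p : Fin n → ℤ) + f' = p' + f := by
    have := sub_eq_sub_iff_add_eq_add.1 hff
    rw [this, add_comm]
  have hmem1 : (p : Fin n → ℤ) + f' ∈ P := P.add_mem p.2 hf'.1
  have hmem2 : (p' : Fin n → ℤ) + f ∈ P := P.add_mem p'.2 hf.1
  have hφ1 : φ (Multiplicative.ofAdd ⟨_, hmem1⟩) = φ (Multiplicative.ofAdd p) *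
      φ (Multiplicative.ofAdd ⟨f', hf'.1⟩) := by
    rw [← map_mul]; rfl
  have hφ2 : φ (Multiplicative.ofAdd ⟨_, hmem2⟩) = φ (Multiplicative.ofAdd p') *
      φ (Multiplicative.ofAdd ⟨f, hf.1⟩) := by
    rw [← map_mul]; rfl
  have heq : φ (Multiplicative.ofAdd ⟨_, hmem1⟩) = φ (Multiplicative.ofAdd ⟨_, hmem2⟩) := by
    congr 2; exact Subtype.ext hpf
  have huf := isUnit_algebraMap_val P φ 𝔭 hf
  have huf' := isUnit_algebraMap_val P φ 𝔭 hf'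
  rw [val_of_mem P φ hf.1] at huf
  rw [val_of_mem P φ hf'.1] at huf'
  refine ⟨algebraMap A _ (φ (Multiplicative.ofAdd ⟨f, hf.1⟩)) * ↑huf'.unit⁻¹, huf.mul (Units.isUnit _), ?_⟩
  have h1 : algebraMap A (Localization.AtPrime 𝔭) (φ (Multiplicative.ofAdd p)) *
      algebraMap A _ (φ (Multiplicative.ofAdd ⟨f', hf'.1⟩)) =
      algebraMap A _ (φ (Multiplicative.ofAdd p')) * algebraMap A _ (φ (Multiplicative.ofAdd ⟨f, hf.1⟩)) := by
    rw [← map_mul (algebraMap A (Localization.AtPrime 𝔭)),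
      ← map_mul (algebraMap A (Localization.AtPrime 𝔭)), ← hφ1, ← hφ2, heq]
  calc algebraMap A (Localization.AtPrime 𝔭) (φ (Multiplicative.ofAdd p))
      = algebraMap A _ (φ (Multiplicative.ofAdd p)) * algebraMap A _ (φ (Multiplicative.ofAdd ⟨f', hf'.1⟩))
          * ↑huf'.unit⁻¹ := by rw [mul_assoc, IsUnit.mul_val_inv, mul_one]
    _ = _ := by rw [h1]; ring

variable [IsNoetherianRing A]

/-- **Nizioł 2006, Lemma 2.4 (1): `M_x^{gp}/𝒪^*_x ≅ P^{gp}/F^{gp}` for log regular charts.** For a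
chart `φ : P → A` by a finitely generated saturated `P ⊆ ℤⁿ`, log regular at the prime `𝔭`
(Kato Def. (2.1)), and `p, p' ∈ P`: if `φ(p) = u · φ(p')` in `A_𝔭` with `u` a unit, then
`p − p'` lies in the subgroup generated by the face `F_𝔭 = {q ∈ P : φ(q) ∉ 𝔭}`. (Reduce to
d-form chart data over `A_𝔭` by the sharp embedding of `P/F_𝔭`, `exists_dformData_of_
isLogRegularAt''`, and apply `chart_eq_of_isUnit_mul_of_dform`.) [cite: Niziol2006, Lemma 2.4]
[cite: Kato1994, (3.2) and (4.1)] -/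
theorem sub_mem_span_faceMonoid_of_isLogRegularAt (hP : P.FG)
    (hsat : ∀ (v : Fin n → ℤ) (k : ℕ), 0 < k → k • v ∈ P → v ∈ P) (hreg : IsLogRegularAt P φ 𝔭)
    (p p' : P) {u : Localization.AtPrime 𝔭} (hu : IsUnit u)
    (h : algebraMap A (Localization.AtPrime 𝔭) (φ (Multiplicative.ofAdd p)) =
      u * algebraMap A (Localization.AtPrime 𝔭) (φ (Multiplicative.ofAdd p'))) :
    (p : Fin n → ℤ) - p' ∈ Submodule.span ℤ (faceMonoid P φ 𝔭 : Set (Fin n → ℤ)) := by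
  obtain ⟨e, he, π, d, t, hD, hcompat⟩ := exists_dformData_of_isLogRegularAt'' hP hsat hreg
  obtain ⟨v, hv⟩ := hcompat p
  obtain ⟨v', hv'⟩ := hcompat p'
  rw [val_of_mem P φ p.2] at hv
  rw [val_of_mem P φ p'.2] at hv'
  have key : embChart he π (embHom he p) = (u * ↑v' * ↑v⁻¹) * embChart he π (embHom he p') := by
    have h1 : embChart he π (embHom he p) = (embChart he π (embHom he p) * ↑v) * ↑v⁻¹ := by
      rw [mul_assoc, Units.mul_inv, mul_one]
    rw [h1, hv, h, ← hv']; ring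
  have hunit : IsUnit (u * ↑v' * ↑v⁻¹ : Localization.AtPrime 𝔭) :=
    (hu.mul (Units.isUnit _)).mul (Units.isUnit _)
  have heq := LogRegularCompleteStructure.chart_eq_of_isUnit_mul_of_dform hD.fg hD.map_zero
    hD.map_add hD.mem_maximalIdeal hD.param_mem hD.gen hD.rank_le ((mem_embMonoid he).2 ⟨p, rfl⟩)
    ((mem_embMonoid he).2 ⟨p', rfl⟩) hunit key
  exact he.inj _ p.2 _ p'.2 ((embHom_eq_iff he).1 heq)

/-- **Nizioł 2006, Lemma 2.4 (1), as an equivalence**: for a log regular chart at `𝔭`,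
`φ(p) ∈ A_𝔭^* · φ(p')` iff `p − p' ∈ ℤ F_𝔭`. [cite: Niziol2006, Lemma 2.4] -/
theorem sub_mem_span_faceMonoid_iff (hP : P.FG)
    (hsat : ∀ (v : Fin n → ℤ) (k : ℕ), 0 < k → k • v ∈ P → v ∈ P) (hreg : IsLogRegularAt P φ 𝔭)
    (p p' : P) :
    (p : Fin n → ℤ) - p' ∈ Submodule.span ℤ (faceMonoid P φ 𝔭 : Set (Fin n → ℤ)) ↔
      ∃ u : Localization.AtPrime 𝔭, IsUnit u ∧
        algebraMap A (Localization.AtPrime 𝔭) (φ (Multiplicative.ofAdd p)) =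
          u * algebraMap A (Localization.AtPrime 𝔭) (φ (Multiplicative.ofAdd p')) :=
  ⟨exists_isUnit_mul_of_sub_mem_span_faceMonoid p p', fun ⟨_, hu, h⟩ =>
    sub_mem_span_faceMonoid_of_isLogRegularAt hP hsat hreg p p' hu h⟩

end LogChart

end Literature.AlgebraicGeometry.Resolution
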